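import Summits.QuantumFields.YangMills.Theorems.UnitScaleTiltProp8FlatHCurlCurlWhole
import Literature.MathematicalPhysics.QuantumFieldTheory.Balaban1983to89.B6Prop25LapDecayTwoScaleV1
import HarnessLib

/-!
# Route `UnitScaleTilt`, crux K1 child «MinimiserStabilityRegPr» (stmt-QuantumFields-19200), v8 pillar **P2 `stub_flatOpsCubeSeq`** — one-level target, row (k4):
# **THE LAPLACIAN KERNEL ROW (k4) OF `FlatOpsHRowsFromKernels.HKernelRows` HOLDS AT THE ONE-LEVEL FAMILY `Domains.whole (K − n)`** — [Balaban1985Variational] (130)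
# at `U = 1` for the one-level `H`: `ΔH = (ΔG)∘Q*(QGQ*)⁻¹` with lit-balaban r03's two-scale block bounds for `ΔG` ([Balaban1984PropagatorsII] Prop. 2.5 / (1.110)₄:
# `B6Prop25LapDecayTwoScaleV1.blockBound_LapG_scaling`) and for `Q*(QGQ*)⁻¹` ((2.148)/(2.150): `B6Cor28TwoScaleV1.blockBound_QsRinv_scaling`) at `Λ′ = ∅`

Cell `ym3-torus` (HUMAN RULING D-0037, YM ladder rung R3), seat `ym3-torus-p1` gen 16.  `--supports stmt-QuantumFields-19200 --as helper`; count-neutral; def-free.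

THE PRINT.  [Balaban1985Variational] (129)–(130) p. 297–298: *«H₀B = GQ*(QGQ*)⁻¹(L^{j(·)}η)⁻¹B … |(Δ_{U₀}H₀)(x, y′)| ≦ B₀(Lʲη)^{−3}(L^{j′}η)^{−d}e^{−δ₀d(y,y′)}»* (the bound
«(3.133) [5] with the additional inequality for the covariant Laplace operator», i.e. the Laplacian member of [Balaban1984PropagatorsI] (1.110) for `G` composed with the kernel of
`Q*(QGQ*)⁻¹`); [Balaban1984PropagatorsII] Cor. 2.8 p. 249 (how print composes `G` with `Q*(QGQ*)⁻¹`: r03's `blockBound_Hts_scaling`).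

WHAT IS PROVED (sorry-free; axioms standard; no definition).
* §1 **`blockBound_LapHts_scaling`** — r03's Corollary-2.8 composition with `G` replaced by `ΔG`: `Σ_{c: site(c)=y}|(ΔH)(e_c)(b₀)| ≤ C·e^{−δ|y(b₀₋) − y|_T}` for the two-scale
  `H = GQ*(QGQ*)⁻¹` (any `Λ′`, window weights), `Δ = Σ_ν∇_ν*∇_ν` at `c = L^j` — `blockBound_LapG_scaling` ∘ `blockBound_QsRinv_scaling` by `blockBound_comp`;
* §2 **`hKernelRow4_whole`** — ROW (k4) AT THE ONE-LEVEL FAMILY: for odd `L > 1` there are `δ₄ > 0`, `C₄ ≥ 0` with, for every member `F.L = L`, heights `n < K`, P2 weights `w`,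
  index bond `c`, indicator `e_c`, fine bond `b`: `w 2 b·(L^{K−n})²·|Σ_ν((flatH e_c)(b) − (flatH e_c)(b+e_ν)) + ((flatH e_c)(b) − (flatH e_c)(b−e_ν))| ≤ C₄·e^{−δ₄·distBI(b,c)}`
  (`flatH (whole (K−n))` IS r03's `Hts` at `Λ′ = ∅` by `FlatHCurlCurlWhole.toLp_H_eq_hOp_twoScale_empty` + `B6Eq235TwoScaleV1.hOp_single_apply`; the stencil is
  `B6BlockDecayGLapBridgeV1.Lap_apply`).
With `FlatRowsWholeLap.rowsAt_whole_of_lapRow` this closes the one-level witness: see `…FlatRowsWholeClosed` (the unconditional `RowsAt` at `whole (K−n)`).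
HONEST SCOPE: bookkeeping over landed certificates; NOT a claim about the mass gap.

References: T. Bałaban, CMP **102** (1985) 277–309 [Balaban1985Variational] (129)–(130) p.297–298, (161) p.303; CMP **96** (1984) 223–250 [Balaban1984PropagatorsII] Prop. 2.5
p.246, (2.148)–(2.151) p.249; CMP **95** (1984) 17–40 [Balaban1984PropagatorsI] (1.110) p.35, (1.63) p.29.
-/

set_option autoImplicit false

noncomputable section

open scoped BigOperators InnerProductSpace Matrix

namespace Summit.QuantumFields.YangMills.Theorems.FlatHLapWhole

open Finset
open Literature.MathematicalPhysics.QuantumFieldTheory.Balaban1983to89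
open Literature.MathematicalPhysics.QuantumFieldTheory.BalabanImbrieJaffe1984to88.BIJ85AxialPropagator411 (BondSpace)
open LatticeFieldCalculus (bondAvgIter)
open B6SectADomainsV1 (Domains)
open B6SectAOperatorsV1 (BondIdx BondIdxSpace QE QsE aE onE)
open B6SectAVectorModelV1 (GE EE)
open B6SectA (hOp)
open B6SectCTwoScaleV1 (twoScale CIdx OutBond InBond CSpace wPrinted)
open B6SectCTwoScaleV1Lattice (tsV1)
open B6Eq2129TwoScaleV1 (toBondIdx toBondIdx_bijective wLevel wLevel_pos)
open B6Eq2143TwoScaleV1 (QGQs)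
open B6Eq235TwoScaleV1 (Hts reindex)
open B4Sect5Proof (latticeConst latticeConst_nonneg)
open B4TorusKernel.MultiPeriod (torusSupNorm)
open B5Eq117TorusCarriers (Mk)
open B5Eq118OneStroke (iterBlockOf)
open B5Prop12FieldsLattice (distSite)
open B6LowerBound2153Torus (rep)
open B6BlockDecayCalculus (blockBound_comp torusDist_isPseudoDist torusDist_sumBound)
open B6Prop25LapDecayTwoScaleV1 (blockBound_LapG_scaling)
open B6Cor28TwoScaleV1 (blockBound_QsRinv_scaling)
open T3ContinuumYM3Torus (T3Family)
open FlatCubeOpsText (distBI IsLevWeight)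
open FlatOpsLettersAssembly (flatH)
open FlatDomainsCongr (lamBond_whole_iff lamBond_twoScale_empty_iff)
open FlatHWholeBridge (flatH_whole_apply)
open FlatHCurlCurlWhole (toLp_H_eq_hOp_twoScale_empty)
open Prop7FlatCoercivityR (succ_le_T3)
open FlatMinimizerH (le_T3)

/-! ## §1 The block bound of `ΔH = (ΔG)Q*(QGQ*)⁻¹` for r03's two-scale `H` -/

section TwoScale

variable {d L m K : ℕ} {hd : 1 ≤ d + 1} {hL : Odd L ∧ 1 < L} {j : ℕ}

open Classical in
/-- **THE DECAY OF `ΔH = (ΔG)·Q*(QGQ*)⁻¹` AS A BLOCK BOUND** (two-scale data `tsV1`, `c = L^j`, weights `a₀n^{d+1} ≤ w ≤ a₁n^{d+1}`, `Δ = Σ_ν∇_ν*∇_ν`): there are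
`δ > 0`, `C ≥ 0` on `d, L, a₀, a₁` with `Σ_{c ∈ 𝔅 : site(c) = y}|(ΔGQ*(QGQ*)⁻¹)(e_c)_{b₀}| ≤ C·e^{−δ|y(b₀₋) − y|_T}` — `blockBound_LapG_scaling` ((1.110)₄ for the two-scale `G`)
composed with `blockBound_QsRinv_scaling` ((2.148)∘`Q*`) by `blockBound_comp`, exactly as r03's `blockBound_Hts_scaling` does for `H` itself.
[cite: Balaban1985Variational, (130) p.298; Balaban1984PropagatorsII, Prop. 2.5 p.246, Cor. 2.8 (2.150)-(2.151) p.249; Balaban1984PropagatorsI, (1.110) p.35] -/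
theorem blockBound_LapHts_scaling (d L : ℕ) (hd : 1 ≤ d + 1) (hL : Odd L ∧ 1 < L) {a₀ a₁ : ℝ} (ha₀ : 0 < a₀) (ha₁ : a₀ ≤ a₁) :
    ∃ δ : ℝ, 0 < δ ∧ ∃ C : ℝ, 0 ≤ C ∧ ∀ (m K : ℕ) (j : ℕ) (hc : ((L : ℝ) ^ j) ≠ 0)
      (_hj : j + 1 ≤ (⟨d + 1, L, m, K, hd, hL⟩ : Params).m + (⟨d + 1, L, m, K, hd, hL⟩ : Params).K)
      (Λ' : Finset (Site (⟨d + 1, L, m, K, hd, hL⟩ : Params) (j + 1))) (w : CIdx j Λ' → ℝ)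
      (_hw0 : ∀ i, a₀ * ((L : ℝ) ^ j) ^ (d + 1) ≤ w i) (_hw1 : ∀ i, w i ≤ a₁ * ((L : ℝ) ^ j) ^ (d + 1))
      (b₀ : PBond (⟨d + 1, L, m, K, hd, hL⟩ : Params) 0) (y : Site (⟨d + 1, L, m, K, hd, hL⟩ : Params) j),
      ∑ i ∈ univ.filter (fun i : CIdx j Λ' => (Sum.elim (fun o : OutBond j Λ' => o.1.src)
            (fun b₁ : InBond j Λ' => Site.blockSite b₁.1.src (fun _ => ⟨0, Params.L_pos _⟩)) :
              CIdx j Λ' → Site (⟨d + 1, L, m, K, hd, hL⟩ : Params) j) i = y),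
          |(((∑ ν : Fin (d + 1), ((((L : ℝ) ^ j) • (onE (LinearMap.funLeft ℝ ℝ (fun b : PBond (⟨d + 1, L, m, K, hd, hL⟩ : Params) 0 =>
              (⟨b.src.unshift ν, b.dir⟩ : PBond (⟨d + 1, L, m, K, hd, hL⟩ : Params) 0))) - LinearMap.id) :
                BondSpace (⟨d + 1, L, m, K, hd, hL⟩ : Params) →ₗ[ℝ] BondSpace (⟨d + 1, L, m, K, hd, hL⟩ : Params))) ∘ₗ
              ((((L : ℝ) ^ j) • (onE (LinearMap.funLeft ℝ ℝ (fun b : PBond (⟨d + 1, L, m, K, hd, hL⟩ : Params) 0 =>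
              (⟨b.src.shift ν, b.dir⟩ : PBond (⟨d + 1, L, m, K, hd, hL⟩ : Params) 0))) - LinearMap.id) :
                BondSpace (⟨d + 1, L, m, K, hd, hL⟩ : Params) →ₗ[ℝ] BondSpace (⟨d + 1, L, m, K, hd, hL⟩ : Params)))) ∘ₗ (tsV1 hc Λ' w).G) ∘ₗ
            (LinearMap.adjoint (tsV1 hc Λ' w).Q ∘ₗ Ring.inverse (QGQs hc Λ' (w := w)))) (EuclideanSpace.single i (1 : ℝ)) b₀| ≤
        C * Real.exp (-(δ * torusSupNorm (Mk (⟨d + 1, L, m, K, hd, hL⟩ : Params) j)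
          (rep (Mk (⟨d + 1, L, m, K, hd, hL⟩ : Params) j) (iterBlockOf j b₀.src) - rep (Mk (⟨d + 1, L, m, K, hd, hL⟩ : Params) j) y))) := by
  obtain ⟨δ₂, hδ₂, C₂, hC₂, hG⟩ := blockBound_LapG_scaling d L hd hL ha₀ ha₁
  obtain ⟨δ₄, hδ₄, C₄, hC₄, hQR⟩ := blockBound_QsRinv_scaling d L hd hL ha₀ ha₁
  have hδH4 : min (δ₂ / 2) δ₄ ≤ δ₄ := min_le_right _ _
  have hδH2 : min (δ₂ / 2) δ₄ < δ₂ := (min_le_left _ _).trans_lt (half_lt_self hδ₂)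
  have hKH : 0 ≤ latticeConst (d + 1) (δ₂ - min (δ₂ / 2) δ₄) := latticeConst_nonneg _ (by linarith)
  refine ⟨min (δ₂ / 2) δ₄, lt_min (half_pos hδ₂) hδ₄, C₂ * C₄ * latticeConst (d + 1) (δ₂ - min (δ₂ / 2) δ₄), by positivity,
    fun m K j hc hj Λ' w hw0 hw1 b₀ y => ?_⟩
  exact blockBound_comp (KY := fun a => latticeConst (d + 1) a) (torusDist_isPseudoDist (Mk (⟨d + 1, L, m, K, hd, hL⟩ : Params) j))
    (torusDist_sumBound (Mk (⟨d + 1, L, m, K, hd, hL⟩ : Params) j))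
    ((∑ ν : Fin (d + 1), ((((L : ℝ) ^ j) • (onE (LinearMap.funLeft ℝ ℝ (fun b : PBond (⟨d + 1, L, m, K, hd, hL⟩ : Params) 0 =>
        (⟨b.src.unshift ν, b.dir⟩ : PBond (⟨d + 1, L, m, K, hd, hL⟩ : Params) 0))) - LinearMap.id) :
          BondSpace (⟨d + 1, L, m, K, hd, hL⟩ : Params) →ₗ[ℝ] BondSpace (⟨d + 1, L, m, K, hd, hL⟩ : Params))) ∘ₗ
        ((((L : ℝ) ^ j) • (onE (LinearMap.funLeft ℝ ℝ (fun b : PBond (⟨d + 1, L, m, K, hd, hL⟩ : Params) 0 =>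
        (⟨b.src.shift ν, b.dir⟩ : PBond (⟨d + 1, L, m, K, hd, hL⟩ : Params) 0))) - LinearMap.id) :
          BondSpace (⟨d + 1, L, m, K, hd, hL⟩ : Params) →ₗ[ℝ] BondSpace (⟨d + 1, L, m, K, hd, hL⟩ : Params)))) ∘ₗ (tsV1 hc Λ' w).G)
    (LinearMap.adjoint (tsV1 hc Λ' w).Q ∘ₗ Ring.inverse (QGQs hc Λ' (w := w)))
    (fun b₀ : PBond (⟨d + 1, L, m, K, hd, hL⟩ : Params) 0 => iterBlockOf j b₀.src)
    (fun b₀ : PBond (⟨d + 1, L, m, K, hd, hL⟩ : Params) 0 => iterBlockOf j b₀.src) (Sum.elim (fun o : OutBond j Λ' => o.1.src)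
          (fun b₁ : InBond j Λ' => Site.blockSite b₁.1.src (fun _ => ⟨0, Params.L_pos _⟩)) :
            CIdx j Λ' → Site (⟨d + 1, L, m, K, hd, hL⟩ : Params) j)
    hC₂ hC₄ (lt_min (half_pos hδ₂) hδ₄).le hδH4 hδH2 (hG m K j hc hj Λ' w hw0 hw1) (hQR m K j hc hj Λ' w hw0 hw1) b₀ y

end TwoScale

/-! ## §2 Row (k4) at the one-level family -/

section Carrier

variable (F : T3Family) (n K : ℕ)

open Classical in
/-- **`flatH (whole (K−n))` IS r03's `Hts` AT `Λ′ = ∅`, entry by entry**: for the indicator `e_c` of the index bond `c = (K−n, cb)`, the fine field `flatH e_c` is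
`Hts(e_{inl cb})` at the weight `a = (L^{K−n})³` (canonicity: p1 g14's `H` = `hOp` of `twoScale (K−n) ∅` = `Hts ∘ reindex⁻¹`).
[cite: Balaban1984PropagatorsII, (2.35) p.228, (2.150) p.249; Balaban1984PropagatorsI, (1.63) p.29] -/
theorem toLp_flatH_whole_eq_Hts_single (cb : PBond (F.P K) (K - n))
    (e : BondIdx (Domains.whole (K - n) (le_T3 F n K) : Domains (F.P K)) → ℝ)
    (he : e ⟨⟨⟨K - n, Nat.lt_succ_self (K - n)⟩, cb⟩, (lamBond_whole_iff (le_T3 F n K) (K - n) cb).2 rfl⟩ = 1)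
    (he' : ∀ c', c' ≠ ⟨⟨⟨K - n, Nat.lt_succ_self (K - n)⟩, cb⟩, (lamBond_whole_iff (le_T3 F n K) (K - n) cb).2 rfl⟩ → e c' = 0) :
    WithLp.toLp 2 (flatH F n K (Domains.whole (K - n) (le_T3 F n K)) e) =
      Hts (P := F.P K) (c := (F.L : ℝ) ^ (K - n)) (pow_ne_zero _ (Nat.cast_ne_zero.2 (F.P K).L_pos.ne') : ((F.L : ℝ) ^ (K - n)) ≠ 0)
        (∅ : Finset (Site (F.P K) (K - n + 1))) (w := wPrinted (F.P K) (K - n) ∅ (((F.L : ℝ) ^ (K - n)) ^ 3))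
        (EuclideanSpace.single (Sum.inl ⟨cb, Finset.notMem_empty _, Finset.notMem_empty _⟩) (1 : ℝ)) := by
  have hj1 : K - n + 1 ≤ (F.P K).m + (F.P K).K := succ_le_T3 F n K
  have hc : ((F.L : ℝ) ^ (K - n)) ≠ 0 := (pow_ne_zero _ (Nat.cast_ne_zero.2 (F.P K).L_pos.ne') : ((F.L : ℝ) ^ (K - n)) ≠ 0)
  have ha : (0 : ℝ) < ((F.L : ℝ) ^ (K - n)) ^ 3 := by
    have : (0 : ℝ) < (F.L : ℝ) := by exact_mod_cast lt_trans zero_lt_one F.hL.2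
    positivity
  have hjlt : K - n < (twoScale (K - n) hj1 (∅ : Finset (Site (F.P K) (K - n + 1)))).k + 1 := by
    show K - n < K - n + 1 + 1; omega
  have hread : (fun cb' : PBond (F.P K) (K - n) =>
        (EuclideanSpace.single (toBondIdx hj1 (∅ : Finset (Site (F.P K) (K - n + 1)))
            (Sum.inl ⟨cb, Finset.notMem_empty _, Finset.notMem_empty _⟩)) (1 : ℝ) :
          BondIdxSpace (twoScale (K - n) hj1 (∅ : Finset (Site (F.P K) (K - n + 1)))))
          ⟨⟨⟨K - n, hjlt⟩, cb'⟩, (lamBond_twoScale_empty_iff hj1 (K - n) cb').2 rfl⟩) =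
      fun cb' : PBond (F.P K) (K - n) => e ⟨⟨⟨K - n, Nat.lt_succ_self (K - n)⟩, cb'⟩, (lamBond_whole_iff (le_T3 F n K) (K - n) cb').2 rfl⟩ := by
    funext cb'
    rw [PiLp.single_apply]
    by_cases h : cb' = cb
    · subst h
      have hcond : (⟨⟨⟨K - n, hjlt⟩, cb'⟩, (lamBond_twoScale_empty_iff hj1 (K - n) cb').2 rfl⟩ :
          BondIdx (twoScale (K - n) hj1 (∅ : Finset (Site (F.P K) (K - n + 1))))) =
          toBondIdx hj1 (∅ : Finset (Site (F.P K) (K - n + 1))) (Sum.inl ⟨cb', Finset.notMem_empty _, Finset.notMem_empty _⟩) := rfl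
      rw [if_pos hcond, he]
    · rw [if_neg, he']
      · intro heq
        apply h
        have := congrArg (fun i : BondIdx (Domains.whole (K - n) (le_T3 F n K) : Domains (F.P K)) => i.1) heq
        simpa using this
      · intro heq
        apply h
        have := congrArg (fun i : BondIdx (twoScale (K - n) hj1 (∅ : Finset (Site (F.P K) (K - n + 1)))) => i.1) heq
        simpa [toBondIdx] using this
  have h1 := toLp_H_eq_hOp_twoScale_empty (P := F.P K) hj1 hc (w := wLevel (F.P K) (K - n) (((F.L : ℝ) ^ (K - n)) ^ 3))
    (wLevel_pos (j := K - n) ha)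
    (fun p => (EuclideanSpace.single (toBondIdx hj1 (∅ : Finset (Site (F.P K) (K - n + 1)))
          (Sum.inl ⟨cb, Finset.notMem_empty _, Finset.notMem_empty _⟩)) (1 : ℝ) :
        BondIdxSpace (twoScale (K - n) hj1 (∅ : Finset (Site (F.P K) (K - n + 1))))) p)
  rw [hread] at h1
  have h2 : WithLp.toLp 2 (fun p => (EuclideanSpace.single (toBondIdx hj1 (∅ : Finset (Site (F.P K) (K - n + 1)))
          (Sum.inl ⟨cb, Finset.notMem_empty _, Finset.notMem_empty _⟩)) (1 : ℝ) :
        BondIdxSpace (twoScale (K - n) hj1 (∅ : Finset (Site (F.P K) (K - n + 1))))) p) =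
      EuclideanSpace.single (toBondIdx hj1 (∅ : Finset (Site (F.P K) (K - n + 1)))
          (Sum.inl ⟨cb, Finset.notMem_empty _, Finset.notMem_empty _⟩)) (1 : ℝ) := by
    ext p; rfl
  rw [h2] at h1
  have hflat : WithLp.toLp 2 (flatH F n K (Domains.whole (K - n) (le_T3 F n K)) e) =
      WithLp.toLp 2 ((B5Eq117TorusCarriers.tV (Nat.le_of_succ_le hj1)).symm (B5TowerOneStroke.pullR (F.P K).L (Mk (F.P K) (K - n)) (K - n)
        (B5Hk163Torus.HkOp ((F.P K).L ^ (K - n)) (Mk (F.P K) (K - n)) *ᵥ B5SectBStatements.cplx (B5Eq117TorusCarriers.tB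
          (fun cb' : PBond (F.P K) (K - n) =>
            e ⟨⟨⟨K - n, Nat.lt_succ_self (K - n)⟩, cb'⟩, (lamBond_whole_iff (le_T3 F n K) (K - n) cb').2 rfl⟩))))) := by
    ext b
    exact flatH_whole_apply F n K e b
  rw [hflat, h1]
  ext b₀
  have h3 := B6Eq235TwoScaleV1.hOp_single_apply hc hj1 (∅ : Finset (Site (F.P K) (K - n + 1))) ha
    (toBondIdx hj1 (∅ : Finset (Site (F.P K) (K - n + 1))) (Sum.inl ⟨cb, Finset.notMem_empty _, Finset.notMem_empty _⟩)) b₀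
  rw [Equiv.ofBijective_symm_apply_apply _ (toBondIdx_bijective hj1 ∅)] at h3
  exact h3

open Classical in
/-- **ROW (k4) OF `HKernelRows` AT THE ONE-LEVEL FAMILY `Domains.whole (K − n)`**: for odd `L > 1` there are `δ₄ > 0`, `C₄ ≥ 0` such that for every member `F.L = L`,
heights `n < K`, P2 weights `w`, index bond `c` with indicator `e_c`, and fine bond `b`:
`w 2 b·(L^{K−n})²·|Σ_ν((flatH e_c)(b) − (flatH e_c)(b+e_ν)) + ((flatH e_c)(b) − (flatH e_c)(b−e_ν))| ≤ C₄·e^{−δ₄·distBI(b,c)}` — §1 at `d + 1 = 3`, `Λ′ = ∅`, window `a₀ = a₁ = 1`,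
the stencil read by `B6BlockDecayGLapBridgeV1.Lap_apply`. [cite: Balaban1985Variational, (130) p.298, (161) p.303; Balaban1984PropagatorsII, Prop. 2.5 p.246, (2.148)-(2.150) p.249] -/
theorem hKernelRow4_whole (L : ℕ) (hL : Odd L ∧ 1 < L) :
    ∃ δ₄ : ℝ, 0 < δ₄ ∧ ∃ C₄ : ℝ, 0 ≤ C₄ ∧ ∀ (F : T3Family), F.L = L → ∀ (n K : ℕ),
      ∀ (w : ℕ → PBond (F.P K) 0 → ℝ), IsLevWeight F n K (Domains.whole (K - n) (le_T3 F n K)) w →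
      ∀ (c : BondIdx (Domains.whole (K - n) (le_T3 F n K) : Domains (F.P K))) (e : BondIdx (Domains.whole (K - n) (le_T3 F n K) : Domains (F.P K)) → ℝ),
        e c = 1 → (∀ c', c' ≠ c → e c' = 0) → ∀ b : PBond (F.P K) 0,
        w 2 b * ((F.L : ℝ) ^ (K - n)) ^ 2 *
            |∑ ν : Fin 3, ((flatH F n K (Domains.whole (K - n) (le_T3 F n K)) e b -
                flatH F n K (Domains.whole (K - n) (le_T3 F n K)) e ⟨b.src.shift ν, b.dir⟩) +
              (flatH F n K (Domains.whole (K - n) (le_T3 F n K)) e b -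
                flatH F n K (Domains.whole (K - n) (le_T3 F n K)) e ⟨b.src.unshift ν, b.dir⟩))| ≤
          C₄ * Real.exp (-(δ₄ * distBI (Domains.whole (K - n) (le_T3 F n K)) b c)) := by
  obtain ⟨δ, hδ, C, hC, hR⟩ := blockBound_LapHts_scaling 2 L (by norm_num) hL one_pos le_rfl
  refine ⟨δ, hδ, C, hC, fun F hF n K w hw c e he he' b => ?_⟩
  subst hF
  -- the index bond `c = (K − n, cb)`
  obtain ⟨⟨⟨j₀, hj₀⟩, cb⟩, hmem⟩ := c
  obtain rfl : j₀ = K - n := (lamBond_whole_iff (le_T3 F n K) j₀ cb).1 hmem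
  have hw2 : w 2 b = 1 := FlatCubeOpsTextWhole.levWeight_whole_eq_one F n K (le_T3 F n K) w hw 2 b
  rw [hw2, one_mul]
  have hj1 : K - n + 1 ≤ (F.P K).m + (F.P K).K := succ_le_T3 F n K
  have hL0 : (0 : ℝ) < (F.L : ℝ) := by exact_mod_cast lt_trans zero_lt_one F.hL.2
  have hLc : ((F.L : ℝ) ^ (K - n)) ≠ 0 := pow_ne_zero _ (Nat.cast_ne_zero.2 (F.P K).L_pos.ne')
  set a : ℝ := ((F.L : ℝ) ^ (K - n)) ^ 3 with ha_def
  have ha : 0 < a := by positivity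
  -- the window `1·(L^j)³ ≤ wPrinted a i ≤ 1·(L^j)³` at `a = (L^{K−n})³`, `Λ′ = ∅`
  have hw0 : ∀ i : CIdx (P := F.P K) (K - n) ∅, 1 * ((F.L : ℝ) ^ (K - n)) ^ (2 + 1) ≤ wPrinted (F.P K) (K - n) ∅ a i := by
    rintro (o | i)
    · simp only [wPrinted, Sum.elim_inl, ha_def, one_mul]
      norm_num
    · exact absurd i.2 (by simp)
  have hw1 : ∀ i : CIdx (P := F.P K) (K - n) ∅, wPrinted (F.P K) (K - n) ∅ a i ≤ 1 * ((F.L : ℝ) ^ (K - n)) ^ (2 + 1) := by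
    rintro (o | i)
    · simp only [wPrinted, Sum.elim_inl, ha_def, one_mul]
      norm_num
    · exact absurd i.2 (by simp)
  have hRb := hR F.m K (K - n) hLc hj1 (∅ : Finset (Site (F.P K) (K - n + 1))) (wPrinted (F.P K) (K - n) ∅ a) hw0 hw1 b cb.src
  have hi₀mem : (Sum.inl ⟨cb, Finset.notMem_empty _, Finset.notMem_empty _⟩ : CIdx (P := F.P K) (K - n) ∅) ∈
      Finset.univ.filter (fun i : CIdx (P := F.P K) (K - n) ∅ =>
      (Sum.elim (fun o : OutBond (P := F.P K) (K - n) ∅ => o.1.src)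
        (fun b₁ : InBond (P := F.P K) (K - n) ∅ => Site.blockSite b₁.1.src (fun _ => ⟨0, Params.L_pos _⟩)) :
        CIdx (P := F.P K) (K - n) ∅ → Site (F.P K) (K - n)) i = cb.src) := by
    simp
  have h1 := (Finset.single_le_sum (fun i _ => abs_nonneg _) hi₀mem).trans hRb
  -- the distance in the exponent is `distBI`
  have hdist : distBI (Domains.whole (K - n) (le_T3 F n K)) b ⟨⟨⟨K - n, hj₀⟩, cb⟩, hmem⟩ =
      distSite (Mk (F.P K) (K - n)) (iterBlockOf (K - n) b.src) cb.src := by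
    change ((F.L : ℝ)⁻¹) ^ ((K - n) - (K - n)) * distSite (Mk (F.P K) (K - n)) (iterBlockOf (K - n) b.src) cb.src = _
    rw [Nat.sub_self, pow_zero, one_mul]
  have hts : distSite (Mk (F.P K) (K - n)) (iterBlockOf (K - n) b.src) cb.src =
      torusSupNorm (Mk (F.P K) (K - n)) (rep (Mk (F.P K) (K - n)) (iterBlockOf (K - n) b.src) - rep (Mk (F.P K) (K - n)) cb.src) :=
    B5Ineq110P12Lattice.distSite_eq_torusSupNorm (Mk (F.P K) (K - n)) (iterBlockOf (K - n) b.src) cb.src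
  -- the stencil is `Lap` of the fine field `flatH e = Hts(e_{inl cb})`
  have hvec := toLp_flatH_whole_eq_Hts_single F n K cb e he he'
  have hstencil : ((F.L : ℝ) ^ (K - n)) ^ 2 *
      |∑ ν : Fin 3, ((flatH F n K (Domains.whole (K - n) (le_T3 F n K)) e b -
          flatH F n K (Domains.whole (K - n) (le_T3 F n K)) e ⟨b.src.shift ν, b.dir⟩) +
        (flatH F n K (Domains.whole (K - n) (le_T3 F n K)) e b -
          flatH F n K (Domains.whole (K - n) (le_T3 F n K)) e ⟨b.src.unshift ν, b.dir⟩))| =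
      |((∑ ν : Fin (F.P K).d, ((((F.L : ℝ) ^ (K - n)) • (onE (LinearMap.funLeft ℝ ℝ (fun b' : PBond (F.P K) 0 =>
              (⟨b'.src.unshift ν, b'.dir⟩ : PBond (F.P K) 0))) - LinearMap.id) : BondSpace (F.P K) →ₗ[ℝ] BondSpace (F.P K))) ∘ₗ
              ((((F.L : ℝ) ^ (K - n)) • (onE (LinearMap.funLeft ℝ ℝ (fun b' : PBond (F.P K) 0 =>
              (⟨b'.src.shift ν, b'.dir⟩ : PBond (F.P K) 0))) - LinearMap.id) : BondSpace (F.P K) →ₗ[ℝ] BondSpace (F.P K))))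
          (WithLp.toLp 2 (flatH F n K (Domains.whole (K - n) (le_T3 F n K)) e))) b| := by
    rw [B6BlockDecayGLapBridgeV1.Lap_apply (P := F.P K) ((F.L : ℝ) ^ (K - n)) _ b, ← Finset.mul_sum, abs_mul,
      abs_of_nonneg (by positivity : (0 : ℝ) ≤ ((F.L : ℝ) ^ (K - n)) ^ 2)]
    congr 1
    congr 1
    refine Finset.sum_congr rfl fun ν _ => ?_
    change _ = 2 * flatH F n K (Domains.whole (K - n) (le_T3 F n K)) e b -
      flatH F n K (Domains.whole (K - n) (le_T3 F n K)) e ⟨b.src.unshift ν, b.dir⟩ -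
      flatH F n K (Domains.whole (K - n) (le_T3 F n K)) e ⟨b.src.shift ν, b.dir⟩
    ring
  rw [hstencil, hvec, hdist, hts]
  refine le_trans (le_of_eq ?_) h1
  rfl

end Carrier

end Summit.QuantumFields.YangMills.Theorems.FlatHLapWhole

end
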